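import Summits.Ventures.PercRepro.RankLevelSetLevelSixHeavyCellSq27DI
import Summits.Ventures.PercRepro.RankLevelSetLevelSixCapGlue25
import Summits.Ventures.PercRepro.TriangleCapEightI
import Summits.Ventures.PercRepro.S1TrianglePlusSharp
import Summits.Ventures.PercRepro.S1SeriesLever14
import Summits.Ventures.PercRepro.RankLevelSetLevelSixArithHeavySq23DF8A

/-!
# PercRepro — THE 24 ROW, THE COLOOP CASE AT CORANK `8`, LEVEL ONE: THE SCALED COLOOP-FREE CELL `(p ≥ 23, 8)` (p8 g10, S3)

`proofs/SUBCLAIM-S3-p8.md` §3x. `(Φ(p+1, 6)/2)·#U(p, 6) ≤ #Y(p, 6)` on every coloop-free `e`-free core of rank `p ≥ 23`, corank `8` (the corrected cell with `D = C(p + 7, 6)`, the parts ArithHeavySq23DF8A and the coloop-free caps at `n₀ = 31`): ratio `0.962`. Axioms: standard.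
-/

open scoped Matroid

namespace PercRepro

namespace ThmN

open Set

variable {α : Type}

/-- **The SCALED cell on every COLOOP-FREE `e`-free core of rank `p ≥ 23`, corank `8`.** -/
theorem c025_core_six_scaled_basis_sq23s8 (M : Matroid α) [M.Finite] (p : ℕ) (hp : 23 ≤ p) (hcf : ∀ e ∈ M.E, ¬ M.IsColoop e)
    (hR : M.eRank = (p : ℕ∞)) (hn : M.E.ncard = p + 8)
    (hfree : ∀ e ∈ M.E, ∃ A ⊆ M.E \ {e}, e ∉ M.closure A ∧ e ∉ M.closure ((M.E \ {e}) \ A)) :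
    phiK (p + 1) 6 / 2 * (Matroid.topCount M p 6 : ℚ) ≤ (Matroid.midCount M p 6 : ℚ) := by
  have hd : M.E.encard = M.eRank + (8 : ℕ) := by
    rw [hR, ← M.ground_finite.cast_ncard_eq, hn]
    push_cast
    ring
  have hL : ∀ e ∈ M.E, ¬ M.IsLoop e := not_isLoop_of_free M hfree
  have hs : ∀ e ∈ M.E, ∀ f ∈ M.E, e ≠ f → M.eRk {e, f} = 2 := by
    intro e he f hf hef
    have h2 : (2 : ℕ∞) ≤ M.eRk {e, f} :=
      two_le_eRk_of_two_le_ncard_of_free M hfree (pair_subset he hf) (by rw [ncard_pair hef])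
    have h3 : M.eRk {e, f} ≤ 2 := by
      have := M.eRk_le_encard {e, f}
      rwa [encard_pair hef] at this
    exact le_antisymm h3 h2
  have hC1 : ∀ L ⊆ M.E, M.eRk L = 2 → L.ncard ≤ 3 :=
    fun L hL hr => ncard_le_three_of_eRk_two M hs hfree hL hr
  have hC2 : ∀ P ⊆ M.E, M.eRk P ≤ 3 → P.ncard ≤ 6 :=
    fun P hP hr => ncard_le_six_of_eRk_le_three_of_free M hfree hP hr
  have hΦ : phiK (p + 1) 6 / 2 ≤ (2 : ℚ) ^ (p + 6) / (((p + 7).choose 6 : ℕ) : ℚ) := by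
    have := phiK_succ_div_two_le p 6
    rwa [show p + 1 + 6 = p + 7 by omega] at this
  exact c025_core_six_heavy_cell_sq27di M p 8 7 2 1 16 14 0 86823 1000 14 429 70 12
      ((p + 7).choose 6) (Nat.choose_pos (by omega)) (phiK (p + 1) 6 / 2) hΦ (by norm_num) (by omega)
      (by norm_num) (by norm_num) (by norm_num) (by norm_num) (by norm_num)
      (by norm_num [cnull]) (by norm_num [cnull]) (Or.inl (by norm_num)) (Or.inl (by norm_num)) (Or.inl (by norm_num)) (by norm_num) (by norm_num) (by norm_num)
      (s3_cf_of M hfree hcf (d := 7) (by simpa using hd) 31 12 (by norm_num) (by omega) (by norm_num [TriangleCap.cq3]) (by norm_num [TriangleCap.cq3]) (by norm_num [TriangleCap.cq3]))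
      (s4_cf_of M hfree hcf (d := 7) (by rw [hd]; norm_num) 31 61 70 (by norm_num) (by omega) (by decide) (by omega))
      (s5_cf_of M hfree hcf (d := 7) (by rw [hd]; norm_num) 31 360 429 (by norm_num) (by omega) (by decide) (by omega))
      (Or.inl (tail_six_heavy_sq23DF8_8 p hp)) hR hn hfree (level_six_poly_heavy_sq23DF8_8 p hp)

end ThmN

end PercRepro
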